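import Summits.QuantumFields.YangMills.Theorems.LuscherReductionTwistedTraceScalingGaugeAverage
import Summits.QuantumFields.YangMills.Theorems.LuscherReductionTwistedTraceScalingCoarseLowerDoors
import HarnessLib

/-!
# Subsolutions WITH A COLLAR REMAINDER: `Λ'(φ − R) ≤ K_βφ` everywhere ⇒ the same for `physAvg`, and the integrated SUB hypothesis of the
# ground-state-transform door from `∫ a² h r ≤ m ∫ a² h²`
# (lane B of S-BASE, crux `TwistedTraceScaling` stmt-QuantumFields-20203; the Laplace step of both COARSE lanes)

WHY (design note for the Laplace comparison).  The temporal-gauge trial state `H = χ_bulk · G` is cut off SHARPLY along the pure-gauge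
directions (zero modes of the stiffness Hessian, `3(|sites|−1)` dimensions, unconfined by the Gaussian `G`); in that many dimensions the mass of
the cut-off ball sits at its boundary, where `(K_βH)/H ≈ ½`.  So the pointwise subsolution inequality `Λ'H ≤ K_βH` can only hold on the CORE
(configurations whose kernel Gaussian stays inside the bulk), which is not gauge invariant, and `…GaugeAverage.physAvg_subsolution` (which
wants it on an invariant set) does not apply.  The usable form is the REMAINDER form: `Λ'(H − R) ≤ K_βH` EVERYWHERE with `R = H·𝟙_collar ≥ 0`;
it averages without any invariance hypothesis (`physAvg_subsolution_remainder`), and feeds the door through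
`integral_sq_mul_transferApply_ge_of_remainder`: (SUB) `Λ'(1 − m)∫a²h² ≤ ∫a²·h·K_βh` as soon as `∫ a²·h·r ≤ m∫a²h²` (`h = physAvg H`,
`r = physAvg R`) — a COLLAR-MASS condition, to be discharged by the smallness of the collar in the Gaussian-confined directions.
Contents: linearity/monotonicity of `physAvg` (`physAvg_mono`, `physAvg_const_mul`, `physAvg_sub`), the two ★ statements above.
HONEST FRAMING: bookkeeping; femto rung R2b1 (stub of a child of a CONDITIONAL route); not a gap, not Clay.
-/

set_option autoImplicit false

noncomputable section

open MeasureTheory Filter Topology Real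
open Literature.MathematicalPhysics.QuantumFieldTheory
open Literature.MathematicalPhysics.QuantumLattice

namespace Summit.QuantumFields.YangMills.Theorems.FemtoTransferGap.TwoLattice.Avg

open Summit.QuantumFields.YangMills.Theorems.FemtoTransferGap
open Summit.QuantumFields.YangMills.Theorems.FemtoTransferGap.TwoLattice.Lower

variable {L : ℕ} [NeZero L]

/-! ## §1 Linearity and monotonicity of `physAvg` -/

/-- `physAvg` is monotone on bounded measurable functions. [folklore] -/
theorem physAvg_mono {φ ψ : GaugeConfig 3 L SU2 → ℝ} (hφ : Measurable φ) (hψ : Measurable ψ) {C D : ℝ} (hφb : ∀ U, |φ U| ≤ C)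
    (hψb : ∀ U, |ψ U| ≤ D) (hle : ∀ U, φ U ≤ ψ U) (U : GaugeConfig 3 L SU2) : physAvg φ U ≤ physAvg ψ U := by
  unfold physAvg
  exact symTwist_mono 2 (symTwist_mono 1 (symTwist_mono 0 (gaugeAvg_mono hφ hψ hφb hψb hle))) U

omit [NeZero L] in
/-- `symTwist k` is additive. [folklore] -/
theorem symTwist_sub (k : Fin 3) (φ ψ : GaugeConfig 3 L SU2 → ℝ) (U : GaugeConfig 3 L SU2) :
    symTwist k (fun V => φ V - ψ V) U = symTwist k φ U - symTwist k ψ U := by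
  simp only [symTwist]; ring

/-- `gaugeAvg (φ − ψ) = gaugeAvg φ − gaugeAvg ψ` (bounded measurable). [folklore] -/
theorem gaugeAvg_sub {φ ψ : GaugeConfig 3 L SU2 → ℝ} (hφ : Measurable φ) (hψ : Measurable ψ) {C D : ℝ} (hφb : ∀ U, |φ U| ≤ C)
    (hψb : ∀ U, |ψ U| ≤ D) (U : GaugeConfig 3 L SU2) : gaugeAvg (fun V => φ V - ψ V) U = gaugeAvg φ U - gaugeAvg ψ U := by
  unfold gaugeAvg
  exact integral_sub (integrable_of_measurable_abs_le _ (measurable_comp_gaugeTransform_left hφ U) fun g => hφb _)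
    (integrable_of_measurable_abs_le _ (measurable_comp_gaugeTransform_left hψ U) fun g => hψb _)

/-- `physAvg (φ − ψ) = physAvg φ − physAvg ψ` (bounded measurable). [folklore] -/
theorem physAvg_sub {φ ψ : GaugeConfig 3 L SU2 → ℝ} (hφ : Measurable φ) (hψ : Measurable ψ) {C D : ℝ} (hφb : ∀ U, |φ U| ≤ C)
    (hψb : ∀ U, |ψ U| ≤ D) (U : GaugeConfig 3 L SU2) : physAvg (fun V => φ V - ψ V) U = physAvg φ U - physAvg ψ U := by
  have h0 : gaugeAvg (fun V => φ V - ψ V) = fun V => gaugeAvg φ V - gaugeAvg ψ V := funext fun V => gaugeAvg_sub hφ hψ hφb hψb V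
  have h1 : symTwist 0 (gaugeAvg fun V => φ V - ψ V) = fun V => symTwist 0 (gaugeAvg φ) V - symTwist 0 (gaugeAvg ψ) V := by
    rw [h0]; exact funext fun V => symTwist_sub 0 _ _ V
  have h2 : symTwist 1 (symTwist 0 (gaugeAvg fun V => φ V - ψ V)) =
      fun V => symTwist 1 (symTwist 0 (gaugeAvg φ)) V - symTwist 1 (symTwist 0 (gaugeAvg ψ)) V := by
    rw [h1]; exact funext fun V => symTwist_sub 1 _ _ V
  unfold physAvg
  rw [h2, symTwist_sub]

/-- `physAvg (Λ·φ) = Λ·physAvg φ`. [folklore] -/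
theorem physAvg_const_mul (Λ : ℝ) (φ : GaugeConfig 3 L SU2 → ℝ) (U : GaugeConfig 3 L SU2) :
    physAvg (fun V => Λ * φ V) U = Λ * physAvg φ U := by
  have h0 : gaugeAvg (fun V => Λ * φ V) = fun V => Λ * gaugeAvg φ V := funext fun V => gaugeAvg_const_mul Λ φ V
  have h1 : symTwist 0 (gaugeAvg fun V => Λ * φ V) = fun V => Λ * symTwist 0 (gaugeAvg φ) V := by
    rw [h0]; exact funext fun V => symTwist_const_mul 0 Λ _ V
  have h2 : symTwist 1 (symTwist 0 (gaugeAvg fun V => Λ * φ V)) = fun V => Λ * symTwist 1 (symTwist 0 (gaugeAvg φ)) V := by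
    rw [h1]; exact funext fun V => symTwist_const_mul 1 Λ _ V
  unfold physAvg
  rw [h2, symTwist_const_mul]

/-! ## §2 Subsolutions with a remainder average without invariance hypotheses -/

/-- ★ **REMAINDER FORM OF THE AVERAGED SUBSOLUTION.**  If `Λ'(φ − R) ≤ K_βφ` EVERYWHERE (bounded measurable `φ`, `R`), then
`Λ'(physAvg φ − physAvg R) ≤ K_β(physAvg φ)` everywhere. [cite: Helffer2013, Lemma 7.1] -/
theorem physAvg_subsolution_remainder (β : ℝ) {φ R : GaugeConfig 3 L SU2 → ℝ} (hφ : Measurable φ) (hR : Measurable R) {C D : ℝ}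
    (hC : ∀ U, |φ U| ≤ C) (hD : ∀ U, |R U| ≤ D) {Λ' : ℝ} (hsub : ∀ U, Λ' * (φ U - R U) ≤ transferApply β φ U)
    (U : GaugeConfig 3 L SU2) : Λ' * (physAvg φ U - physAvg R U) ≤ transferApply β (physAvg φ) U := by
  haveI : SecondCountableTopology SU2 := secondCountableTopology_su2
  obtain ⟨M, hM⟩ := exists_transferKernel_le su2Rep continuous_su2Rep β (L := L)
  rw [transferApply_physAvg β hφ hC]
  have hKm : Measurable (transferApply β φ) := measurable_transferApply β hφ
  have hKb : ∀ U, |transferApply β φ U| ≤ M * C := abs_transferApply_le β hM hφ hC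
  have hdm : Measurable fun V => φ V - R V := hφ.sub hR
  have hdb : ∀ V, |φ V - R V| ≤ C + D := fun V => (abs_sub _ _).trans (add_le_add (hC V) (hD V))
  have hlm : Measurable fun V => Λ' * (φ V - R V) := hdm.const_mul Λ'
  have hlb : ∀ V, |Λ' * (φ V - R V)| ≤ |Λ'| * (C + D) := fun V => by
    rw [abs_mul]; exact mul_le_mul_of_nonneg_left (hdb V) (abs_nonneg _)
  have h := physAvg_mono hlm hKm hlb hKb hsub U
  rwa [physAvg_const_mul, physAvg_sub hφ hR hC hD] at h

/-! ## §3 The integrated SUB hypothesis of the ground-state-transform door from a collar-mass bound -/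

/-- ★ **(SUB) FROM THE REMAINDER FORM.**  `h ≥ 0`, `a` bounded measurable, `Λ' ≥ 0`, `Λ'(h − r) ≤ K_βh` everywhere, and the collar-mass
bound `∫ a²·h·r ≤ m·∫ a²h²` give `Λ'(1 − m)·∫a²h² ≤ ∫ a²·h·(K_βh)` — hypothesis (SUB) of
`…CoarseLowerDoors.le_levelValue_of_groundStateTransform` with `Λ'(1−m)` in place of `Λ'`. [cite: GlimmJaffe1987, §19.2] -/
theorem integral_sq_mul_transferApply_ge_of_remainder {β : ℝ} {a h r : GaugeConfig 3 L SU2 → ℝ} (ham : Measurable a)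
    (hhm : Measurable h) (hrm : Measurable r) {Ca Ch Cr : ℝ} (hab : ∀ U, |a U| ≤ Ca) (hhb : ∀ U, |h U| ≤ Ch) (hrb : ∀ U, |r U| ≤ Cr)
    (hh0 : ∀ U, 0 ≤ h U) {Λ' m : ℝ} (hΛ' : 0 ≤ Λ') (hsub : ∀ U, Λ' * (h U - r U) ≤ transferApply β h U)
    (hmass : ∫ U, a U ^ 2 * (h U * r U) ∂configMeasure SU2 L ≤ m * ∫ U, a U ^ 2 * h U ^ 2 ∂configMeasure SU2 L) :
    Λ' * (1 - m) * ∫ U, a U ^ 2 * h U ^ 2 ∂configMeasure SU2 L ≤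
      ∫ U, a U ^ 2 * (h U * transferApply β h U) ∂configMeasure SU2 L := by
  haveI : SecondCountableTopology SU2 := secondCountableTopology_su2
  obtain ⟨M, hM⟩ := exists_transferKernel_le su2Rep continuous_su2Rep β (L := L)
  set μ := configMeasure SU2 L with hμ
  have hKm : Measurable (transferApply β h) := measurable_transferApply β hhm
  have hKb : ∀ U, |transferApply β h U| ≤ M * Ch := abs_transferApply_le β hM hhm hhb
  -- integrability of the three integrands (bounded measurable on a probability space)
  have hi1 : Integrable (fun U => a U ^ 2 * h U ^ 2) μ :=
    integrable_of_measurable_abs_le _ ((ham.pow_const 2).mul (hhm.pow_const 2)) (C := Ca ^ 2 * Ch ^ 2) fun U => by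
      rw [abs_mul, abs_pow, abs_pow]
      exact mul_le_mul (pow_le_pow_left₀ (abs_nonneg _) (hab U) 2) (pow_le_pow_left₀ (abs_nonneg _) (hhb U) 2) (by positivity)
        (by positivity)
  have hi2 : Integrable (fun U => a U ^ 2 * (h U * r U)) μ :=
    integrable_of_measurable_abs_le _ ((ham.pow_const 2).mul (hhm.mul hrm)) (C := Ca ^ 2 * (Ch * Cr)) fun U => by
      rw [abs_mul, abs_pow, abs_mul]
      exact mul_le_mul (pow_le_pow_left₀ (abs_nonneg _) (hab U) 2) (mul_le_mul (hhb U) (hrb U) (abs_nonneg _)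
        ((abs_nonneg _).trans (hhb U))) (by positivity) (by positivity)
  have hi3 : Integrable (fun U => a U ^ 2 * (h U * transferApply β h U)) μ :=
    integrable_of_measurable_abs_le _ ((ham.pow_const 2).mul (hhm.mul hKm)) (C := Ca ^ 2 * (Ch * (M * Ch))) fun U => by
      rw [abs_mul, abs_pow, abs_mul]
      exact mul_le_mul (pow_le_pow_left₀ (abs_nonneg _) (hab U) 2) (mul_le_mul (hhb U) (hKb U) (abs_nonneg _)
        ((abs_nonneg _).trans (hhb U))) (by positivity) (by positivity)
  -- pointwise: `a²·Λ'(h² − h r) ≤ a²·h·K h`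
  have hpt : ∀ U, Λ' * (a U ^ 2 * h U ^ 2) - Λ' * (a U ^ 2 * (h U * r U)) ≤ a U ^ 2 * (h U * transferApply β h U) := fun U => by
    have h1 := mul_le_mul_of_nonneg_left (hsub U) (mul_nonneg (sq_nonneg (a U)) (hh0 U))
    nlinarith [h1]
  have hint : ∫ U, (Λ' * (a U ^ 2 * h U ^ 2) - Λ' * (a U ^ 2 * (h U * r U))) ∂μ ≤
      ∫ U, a U ^ 2 * (h U * transferApply β h U) ∂μ :=
    integral_mono ((hi1.const_mul Λ').sub (hi2.const_mul Λ')) hi3 hpt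
  rw [integral_sub (hi1.const_mul Λ') (hi2.const_mul Λ'), integral_const_mul, integral_const_mul] at hint
  have hm' := mul_le_mul_of_nonneg_left hmass hΛ'
  nlinarith [hint, hm']

end Summit.QuantumFields.YangMills.Theorems.FemtoTransferGap.TwoLattice.Avg

end
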